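import Literature.NumberTheory.Rogawski1990.RankOneUnstableDeltaValueRamified   -- ★ R-4 p843425 (B-p10 (g26)): `exists_finHeckeValue_sub_inv_eq_mul_hilbertSymbol`, `exists_skew_ne_zero`, Cayley parameter
import Literature.NumberTheory.QuadraticForms.HilbertSymbolBilinear               -- ★ `hilbertSymbol_adicCompletion_mul_left` (O'Meara 63:13a, every finite place, dyadic included)
import Literature.NumberTheory.QuadraticForms.HilbertSymbolRegular                -- ★ `hilbertSymbol_inv_left`
import HarnessLib

/-!
# [Rogawski1990 Lemma 4.9.3; LabesseLanglands1979 §2; Labesse2024 Prop. 0.0.11] road «W′» = «R1LL-WILD», brick (W′5′-ALG):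
# THE Δ-SIDE SYMBOL IN TORUS COORDINATES — `ι_w b₀ = bcoord ∕ trc` and `(b₀, θ)_v = (bc, θ)_v · (tc, θ)_v`

Topic `NumberTheory/Rogawski1990`; namespace `Literature.NumberTheory.Rogawski1990`.  THEOREMS ONLY (no definition, no instance, no notation, no named fact, no `sorry`).
Cell `pub/hodgecm-mathlib` (D-0151), crux H413 = `stmt-HodgeConjecture-24833`, line «N6nsGerm», the WILDLY RAMIFIED residue `stub_N6nsR1ramWild`
(`RankOneUnstableTransferNonsplitCMERamifiedWild`, ★ def p843764) of books row #165; LEAD F0P3a-plan (g10) WORD T9-25, architect A-p16 (g28) RULINGS A-32 ∕ A-35 (a)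
(«route-independent Δ-side bricks»); hand B-p12 (g30), census `F0/P3a/B-p12/g30/CENSUS-W5prime-ALG-DeltaSymbolTorusCoords.B-p12g30.md`.  HONEST LABEL: HC_CM is proved
only modulo the printed citations (the 2 remaining named inputs hLiu418, h413) until rung 0 closes; nothing printed is asserted here — one-place field algebra and the
bimultiplicativity of the local Hilbert symbol.

THE MATHEMATICS.  ★ R-4 (`RankOneUnstableDeltaValueRamified`) reads the `μ`-part of the rank-one transfer factor at a non-split place `w ∣ v` of the CM field `L` through the
CAYLEY PARAMETER `b₀ ∈ L⁺_vˣ` of the norm-one ratio `z = a_w ∕ c_w` of two eigenvalues: `ι_w b₀ = (z − 1)∕((z + 1)·η)` for a fixed skew `η` (`σ_w η = −η`), and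
`μ_v(a − c)⁻¹ = μ_v(c)⁻¹ · C⁻¹ · (b₀, θ)_v`.  The wild END of road «W′» (A-32: Labesse's display, `hD` as a definition, `ε t := (bcoord t, θ)_v`) wants this symbol SPLIT into
the symbol of a «`τ`-coordinate» and the symbol of a «trace», both read in `L⁺_v`.  CAVEAT recorded by the census (§0 there): the frame eigenvalues `τ₀ t, τ₁ t` of the road
are EACH NORM-ONE (`σ_w τᵢ = τᵢ⁻¹`, ★ `normOne_frame_of_mem_centralizer`), so `τ₀ + τ₁` and `(τ₀ − τ₁)∕η` are NOT `σ_w`-fixed (`σ_w(τ₀ + τ₁) = (τ₀ + τ₁)∕(τ₀τ₁)`); the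
`L⁺_v`-rational coordinates are those of a HILBERT-90 NUMERATOR `x` of `z` (`x = z · σ_w x` — Labesse's `t = a + bτ ∈ T̃ = E^×`, [Labesse2024 Prop. 0.0.11], whose class in
`PGL₂(F_v)` is what acts on the tree): `bx := (x − σ_w x)∕η`, `tx := x + σ_w x` ARE fixed and `(z − 1)∕((z + 1)η) = bx ∕ tx` EXACTLY (§1).  The CANONICAL numerator near the
singular locus is `x := 1 + z` (`σ_w(1 + z) = 1 + z⁻¹ = (1 + z)∕z`): `bcoord = (z − z⁻¹)∕η`, `trc = z + z⁻¹ + 2 = (z + 1)²∕z`, with `trc − 4 = (z − 1)²∕z` — so the trace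
symbol `(tc, θ)_v` tends to `(4, θ)_v = 1` along the torus (the interface for A-35 (b)).
* §1 ONE-PLACE ALGEBRA over any field `K` with a ring endomorphism `σ`: `cayley_div_eq_sub_div_add` (the literal identity `(τ₀∕τ₁ − 1)∕((τ₀∕τ₁ + 1)η) = ((τ₀ − τ₁)∕η)∕(τ₀ + τ₁)`),
  `map_sub_map_div_eq_of_skew` ∕ `map_add_map_eq` (the numerator coordinates are `σ`-fixed), `cayley_eq_numerator_coords` (`(z−1)∕((z+1)η) = bx∕tx` for `x = z·σx`),
  `cayley_eq_canonical_coords` (`x = 1 + z`), `map_sub_inv_div_eq_of_normOne` ∕ `map_add_inv_add_two_eq_of_normOne` (fixedness for norm-one `z`), `add_inv_add_two_sub_four`.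
* §2 AT THE PLACE `w`: `exists_units_toPlace_eq_sub_inv_div` ∕ `exists_units_toPlace_eq_add_inv_add_two` (the coordinates `bc, tc ∈ L⁺_vˣ` of a norm-one `z ≠ ±1`, ★
  `exists_toPlace_eq_of_galAdicCompletionMap_eq`), and the SYMBOL SPLIT `hilbertSymbol_eq_mul_of_toPlace_eq_div`: `ι_w b₀ = ι_w bc ∕ ι_w tc ⇒ (b₀, d)_v = (bc, d)_v · (tc, d)_v`
  (★ `hilbertSymbol_adicCompletion_mul_left`, ★ `hilbertSymbol_inv_left`).
* §3 THE CM READING in R-4's letter tokens (`a c : LocalRing L v` both norm-one — the `hd1` of every frame of the road): `exists_units_toPlace_eq_bcoord_of_normOne`,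
  `exists_units_toPlace_eq_trc_of_normOne`, `toPlace_cayley_eq_div_of_coords`, `toPlace_trc_sub_four` ∕ `valued_toPlace_trc_sub_four` (`|ι tc − 4|_w = |a_w − c_w|_w²`), and the
  HEAD `exists_finHeckeValue_sub_inv_eq_mul_hilbertSymbol_coords` = ★ R-4's head VERBATIM with `b₀ ↦ (bc, tc)`:
  `μ_v(a − c)⁻¹ = μ_v(c)⁻¹ · C⁻¹ · (bc, θ)_v · (tc, θ)_v`.
NOT here: the eventual constancy of `t ↦ (tc(t), θ)_v` along `Z(t₀)` ((W′5′-LC), A-p03 (g26)); the torus dress `a := τ₀ t`, `c := τ₁ t` (the END layer's one `obtain`, as ★ R-4c⁺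
does for ★ R-4); any evaluation of `(bc, θ)_v` (never a residue symbol at a wild place — A-32 (I3)).

## References
* [Rogawski1990] J. D. Rogawski, *Automorphic Representations of Unitary Groups in Three Variables*, Ann. of Math. Stud. 123 (1990): §4.9 Lemma 4.9.3, (4.9.2) p. 56; §4.9
  p. 55 (`μ|_{F^×} = ω_{E∕F}`, the factor `μ⁻¹(γ₁ − γ₃)`).
* [LabesseLanglands1979] J.-P. Labesse, R. P. Langlands, *L-indistinguishability for SL(2)*, Canad. J. Math. 31 (1979): §2 (2.1)–(2.2) pp. 7–9 (`γ = a + bτ`, the weight `κ(b)`).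
* [Labesse2024StabilisationGermesSL2] J.-P. Labesse, *Stabilisation des germes de SL(2)* (arXiv:2411.14820, 2024): Prop. 0.0.10–0.0.11, Th. 0.0.12 pp. 7–8 (`G̃ = GL₂`, `T̃ = E^×`,
  `κ(c₂) = κ(det x̃)·κ(b)`, the ramified display with `C(μ) = 2|μ|`).
* [Serre1979] J.-P. Serre, *Local Fields*, GTM 67 (1979): Ch. X §1 (Hilbert 90), Ch. XIV §3 (the local symbol, bimultiplicativity).
* [Omeara1963] O. T. O'Meara, *Introduction to Quadratic Forms* (1963): §63B, 63:13a (the Hilbert symbol is multiplicative in each variable over a local field).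
-/

set_option autoImplicit false

noncomputable section

open NumberField IsDedekindDomain Filter Topology ValuativeRel
open scoped ValuativeRel

namespace Literature.NumberTheory.Rogawski1990

open Literature.NumberTheory.Automorphic Literature.NumberTheory.Automorphic.UnitaryGroup Literature.NumberTheory.GaloisRepresentations
open Literature.NumberTheory.QuadraticForms Literature.NumberTheory.NumberFields

/-! ## §1 One-place algebra over a field with an endomorphism `σ` -/

section Algebra

variable {K : Type*} [Field K]

/-- **THE LITERAL IDENTITY** `(τ₀∕τ₁ − 1)∕((τ₀∕τ₁ + 1)·η) = ((τ₀ − τ₁)∕η)∕(τ₀ + τ₁)` (`τ₁ ≠ 0`, `τ₀ + τ₁ ≠ 0`; for `η = 0` both sides are the junk value `0`): the Cayley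
parameter of the eigenvalue ratio in terms of difference and sum. [cite: LabesseLanglands1979, §2 (2.1)] -/
theorem cayley_div_eq_sub_div_add {τ₀ τ₁ η : K} (h₁ : τ₁ ≠ 0) (hs : τ₀ + τ₁ ≠ 0) :
    (τ₀ / τ₁ - 1) / ((τ₀ / τ₁ + 1) * η) = ((τ₀ - τ₁) / η) / (τ₀ + τ₁) := by
  by_cases hη : η = 0
  · simp [hη]
  have hs' : τ₀ / τ₁ + 1 ≠ 0 := by
    rw [div_add_one h₁]; exact div_ne_zero hs h₁
  field_simp

variable (σ : K →+* K)

/-- **THE DIFFERENCE COORDINATE OF A NUMERATOR IS `σ`-FIXED**: if `σ` is an involution on `x` (`σ(σx) = x`) and `ση = −η` then `σ((x − σx)∕η) = (x − σx)∕η`.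
[cite: Labesse2024StabilisationGermesSL2, Prop. 0.0.11 (`t = a + bτ`, `b ∈ F`)] -/
theorem map_sub_map_div_eq_of_skew {x η : K} (hσσ : σ (σ x) = x) (hη : σ η = -η) :
    σ ((x - σ x) / η) = (x - σ x) / η := by
  rw [map_div₀, map_sub, hσσ, hη, ← neg_sub, neg_div_neg_eq]

/-- **THE SUM COORDINATE OF A NUMERATOR IS `σ`-FIXED**: `σ(x + σx) = x + σx` when `σ(σx) = x`. [cite: Labesse2024StabilisationGermesSL2, Prop. 0.0.11] -/
theorem map_add_map_eq {x : K} (hσσ : σ (σ x) = x) : σ (x + σ x) = x + σ x := by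
  rw [map_add, hσσ, add_comm]

/-- **THE CAYLEY PARAMETER IN NUMERATOR COORDINATES**: if `x = z · σx` is a (Hilbert-90) numerator of `z` with `σx ≠ 0`, `x + σx ≠ 0`, then
`(z − 1)∕((z + 1)·η) = ((x − σx)∕η)∕(x + σx)` — `(z − 1)∕(z + 1) = (x − σx)∕(x + σx)`.  (For `η = 0` both sides are `0`.)
[cite: Labesse2024StabilisationGermesSL2, Prop. 0.0.11] [cite: Serre1979, Ch. X §1] -/
theorem cayley_eq_numerator_coords {x z η : K} (hx : x = z * σ x) (hσx : σ x ≠ 0) (hsum : x + σ x ≠ 0) :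
    (z - 1) / ((z + 1) * η) = ((x - σ x) / η) / (x + σ x) := by
  have hz : z = x / σ x := by rw [eq_div_iff hσx]; exact hx.symm
  rw [hz]
  exact cayley_div_eq_sub_div_add hσx hsum

/-- **THE CANONICAL NUMERATOR `x := 1 + z`**: for `z ≠ 0`, `z + 1 ≠ 0`: `(z − 1)∕((z + 1)·η) = ((z − z⁻¹)∕η)∕(z + z⁻¹ + 2)` (`z − z⁻¹ = (z² − 1)∕z`, `z + z⁻¹ + 2 = (z + 1)²∕z`).
[cite: Labesse2024StabilisationGermesSL2, Prop. 0.0.11] -/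
theorem cayley_eq_canonical_coords {z η : K} (hz0 : z ≠ 0) (hz1 : z + 1 ≠ 0) :
    (z - 1) / ((z + 1) * η) = ((z - z⁻¹) / η) / (z + z⁻¹ + 2) := by
  by_cases hη : η = 0
  · simp [hη]
  have h1 : z - z⁻¹ = (z - 1) * (z + 1) / z := by field_simp; ring
  have h2 : z + z⁻¹ + 2 = (z + 1) ^ 2 / z := by field_simp; ring
  have hp : (z + 1) ^ 2 ≠ 0 := pow_ne_zero 2 hz1
  rw [h1, h2]
  field_simp

/-- `σz · z = 1 ⇒ σz = z⁻¹`. [cite: Serre1979, Ch. X §1] -/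
theorem map_eq_inv_of_map_mul_self {z : K} (hz : σ z * z = 1) : σ z = z⁻¹ :=
  eq_inv_of_mul_eq_one_left hz

/-- **`(z − z⁻¹)∕η` IS `σ`-FIXED** for norm-one `z` (`σz · z = 1`, `σ(σz) = z`) and skew `η`. [cite: Labesse2024StabilisationGermesSL2, Prop. 0.0.11] -/
theorem map_sub_inv_div_eq_of_normOne {z η : K} (hz : σ z * z = 1) (hσσ : σ (σ z) = z) (hη : σ η = -η) :
    σ ((z - z⁻¹) / η) = (z - z⁻¹) / η := by
  have hσz : σ z = z⁻¹ := map_eq_inv_of_map_mul_self σ hz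
  have hσzi : σ z⁻¹ = z := by rw [← hσz, hσσ]
  rw [map_div₀, map_sub, hσz, hσzi, hη, ← neg_sub, neg_div_neg_eq]

/-- **`z + z⁻¹ + 2` IS `σ`-FIXED** for norm-one `z`. [cite: Labesse2024StabilisationGermesSL2, Prop. 0.0.11] -/
theorem map_add_inv_add_two_eq_of_normOne {z : K} (hz : σ z * z = 1) (hσσ : σ (σ z) = z) :
    σ (z + z⁻¹ + 2) = z + z⁻¹ + 2 := by
  have hσz : σ z = z⁻¹ := map_eq_inv_of_map_mul_self σ hz
  have hσzi : σ z⁻¹ = z := by rw [← hσz, hσσ]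
  rw [map_add, map_add, hσz, hσzi, map_ofNat, add_comm z⁻¹ z]

/-- **`1 + z` IS A NUMERATOR OF A NORM-ONE `z`**: `1 + z = z · σ(1 + z)` (`σz = z⁻¹`, `z ≠ 0`). [cite: Serre1979, Ch. X §1 (Hilbert 90)] -/
theorem one_add_eq_mul_map_one_add_of_normOne {z : K} (hz : σ z * z = 1) : 1 + z = z * σ (1 + z) := by
  have hz0 : z ≠ 0 := fun h0 => by rw [h0, mul_zero] at hz; exact zero_ne_one hz
  rw [map_add, map_one, map_eq_inv_of_map_mul_self σ hz, mul_add, mul_one, mul_inv_cancel₀ hz0, add_comm]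

/-- The coordinates of the canonical numerator: `(1 + z) − σ(1 + z) = z − z⁻¹` and `(1 + z) + σ(1 + z) = z + z⁻¹ + 2`. [cite: Labesse2024StabilisationGermesSL2, Prop. 0.0.11] -/
theorem one_add_sub_map_one_add_of_normOne {z : K} (hz : σ z * z = 1) :
    (1 + z) - σ (1 + z) = z - z⁻¹ ∧ (1 + z) + σ (1 + z) = z + z⁻¹ + 2 := by
  rw [map_add, map_one, map_eq_inv_of_map_mul_self σ hz]
  constructor <;> ring

/-- **THE TRACE COORDINATE NEAR THE SINGULAR LOCUS**: `z + z⁻¹ + 2 − 4 = (z − 1)²∕z` (`z ≠ 0`) — it tends to `4 = 2²` as `z → 1`. [cite: LabesseLanglands1979, §2 (2.2)] -/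
theorem add_inv_add_two_sub_four {z : K} (hz0 : z ≠ 0) : z + z⁻¹ + 2 - 4 = (z - 1) ^ 2 / z := by
  field_simp
  ring

/-- `z − z⁻¹ ≠ 0` for `z ≠ 0, ±1` (`z − z⁻¹ = (z − 1)(z + 1)∕z`). [folklore] -/
private theorem sub_inv_ne_zero {z : K} (hz0 : z ≠ 0) (hz1 : z - 1 ≠ 0) (hz1' : z + 1 ≠ 0) : z - z⁻¹ ≠ 0 := by
  rw [show z - z⁻¹ = (z - 1) * (z + 1) / z by field_simp; ring]
  exact div_ne_zero (mul_ne_zero hz1 hz1') hz0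

/-- `z + z⁻¹ + 2 ≠ 0` for `z ≠ 0, −1` (`= (z + 1)²∕z`). [folklore] -/
private theorem add_inv_add_two_ne_zero {z : K} (hz0 : z ≠ 0) (hz1' : z + 1 ≠ 0) : z + z⁻¹ + 2 ≠ 0 := by
  rw [show z + z⁻¹ + 2 = (z + 1) ^ 2 / z by field_simp; ring]
  exact div_ne_zero (pow_ne_zero 2 hz1') hz0

end Algebra

/-! ## §2 At a non-split place: the coordinates lie in `L⁺_v`, and the Hilbert symbol splits -/

section Place

variable (L : Type) [Field L] [NumberField L] [IsCMField L] (v : HeightOneSpectrum (𝓞 ↥(maximalRealSubfield L)))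
  (w : PlacesOver L v) (hw : IsCMField.complexConj L • w.1 = w.1)

include hw in
/-- **THE DIFFERENCE COORDINATE `bc ∈ L⁺_vˣ` OF A NORM-ONE `z ≠ ±1`**: `ι_w bc = (z − z⁻¹)∕η` for the fixed skew `η ≠ 0` (the quotient is `σ_w`-fixed, hence from `L⁺_v`, ★
`exists_toPlace_eq_of_galAdicCompletionMap_eq`). [cite: Labesse2024StabilisationGermesSL2, Prop. 0.0.11] [cite: LabesseLanglands1979, §2 (2.1)] -/
theorem exists_units_toPlace_eq_sub_inv_div {η : w.1.adicCompletion L} (hη : galAdicCompletionMap (L := L) (IsCMField.complexConj L) hw η = -η) (hη0 : η ≠ 0)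
    {z : w.1.adicCompletion L} (hz : galAdicCompletionMap (L := L) (IsCMField.complexConj L) hw z * z = 1) (hz1 : z - 1 ≠ 0) (hz1' : z + 1 ≠ 0) :
    ∃ bc : (v.adicCompletion ↥(maximalRealSubfield L))ˣ, toPlace v w (bc : v.adicCompletion ↥(maximalRealSubfield L)) = (z - z⁻¹) / η := by
  have hz0 : z ≠ 0 := fun h0 => by rw [h0, mul_zero] at hz; exact zero_ne_one hz
  have hfix := map_sub_inv_div_eq_of_normOne (galAdicCompletionMap (L := L) (IsCMField.complexConj L) hw) hz
    (galAdicCompletionMap_complexConj_self L v w hw z) hη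
  obtain ⟨p, hp⟩ := exists_toPlace_eq_of_galAdicCompletionMap_eq (IsCMField.complexConj L) w (IsCMField.complexConj_ne_one L) hw _ hfix
  have hp0 : p ≠ 0 := by
    intro h0
    rw [h0, map_zero] at hp
    exact div_ne_zero (sub_inv_ne_zero hz0 hz1 hz1') hη0 hp.symm
  exact ⟨Units.mk0 p hp0, by rw [Units.val_mk0, hp]⟩

include hw in
/-- **THE TRACE COORDINATE `tc ∈ L⁺_vˣ` OF A NORM-ONE `z ≠ −1`**: `ι_w tc = z + z⁻¹ + 2`. [cite: Labesse2024StabilisationGermesSL2, Prop. 0.0.11] -/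
theorem exists_units_toPlace_eq_add_inv_add_two {z : w.1.adicCompletion L} (hz : galAdicCompletionMap (L := L) (IsCMField.complexConj L) hw z * z = 1) (hz1' : z + 1 ≠ 0) :
    ∃ tc : (v.adicCompletion ↥(maximalRealSubfield L))ˣ, toPlace v w (tc : v.adicCompletion ↥(maximalRealSubfield L)) = z + z⁻¹ + 2 := by
  have hz0 : z ≠ 0 := fun h0 => by rw [h0, mul_zero] at hz; exact zero_ne_one hz
  have hfix := map_add_inv_add_two_eq_of_normOne (galAdicCompletionMap (L := L) (IsCMField.complexConj L) hw) hz
    (galAdicCompletionMap_complexConj_self L v w hw z)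
  obtain ⟨p, hp⟩ := exists_toPlace_eq_of_galAdicCompletionMap_eq (IsCMField.complexConj L) w (IsCMField.complexConj_ne_one L) hw _ hfix
  have hp0 : p ≠ 0 := by
    intro h0
    rw [h0, map_zero] at hp
    exact add_inv_add_two_ne_zero hz0 hz1' hp.symm
  exact ⟨Units.mk0 p hp0, by rw [Units.val_mk0, hp]⟩

omit [IsCMField L] in
/-- **THE SYMBOL SPLITS**: if `ι_w b₀ = ι_w bc ∕ ι_w tc` for units `b₀ bc tc` of `L⁺_v` then `b₀ = bc · tc⁻¹` and, for every `d ≠ 0`, `(b₀, d)_v = (bc, d)_v · (tc, d)_v`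
(bimultiplicativity of the local Hilbert symbol at every finite place, ★ `hilbertSymbol_adicCompletion_mul_left`, and `(x⁻¹, d) = (x, d)`).
[cite: Omeara1963, §63B 63:13a] [cite: Serre1979, Ch. XIV §3] -/
theorem hilbertSymbol_eq_mul_of_toPlace_eq_div (b₀ bc tc : (v.adicCompletion ↥(maximalRealSubfield L))ˣ)
    (h : toPlace v w (b₀ : v.adicCompletion ↥(maximalRealSubfield L)) =
      toPlace v w (bc : v.adicCompletion ↥(maximalRealSubfield L)) / toPlace v w (tc : v.adicCompletion ↥(maximalRealSubfield L)))
    {d : v.adicCompletion ↥(maximalRealSubfield L)} (hd : d ≠ 0) :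
    hilbertSymbol (v.adicCompletion ↥(maximalRealSubfield L)) (b₀ : v.adicCompletion ↥(maximalRealSubfield L)) d =
      hilbertSymbol (v.adicCompletion ↥(maximalRealSubfield L)) (bc : v.adicCompletion ↥(maximalRealSubfield L)) d *
        hilbertSymbol (v.adicCompletion ↥(maximalRealSubfield L)) (tc : v.adicCompletion ↥(maximalRealSubfield L)) d := by
  have hb : (b₀ : v.adicCompletion ↥(maximalRealSubfield L)) = bc * (tc : v.adicCompletion ↥(maximalRealSubfield L))⁻¹ := by
    apply (toPlace v w).injective
    rw [h, map_mul, map_inv₀, div_eq_mul_inv]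
  rw [hb, hilbertSymbol_adicCompletion_mul_left ↥(maximalRealSubfield L) v bc.ne_zero (inv_ne_zero tc.ne_zero) hd, hilbertSymbol_inv_left tc.ne_zero]

omit [IsCMField L] in
/-- The `ℂ`-cast form of `hilbertSymbol_eq_mul_of_toPlace_eq_div` (the road's currency `((·,·)_v : ℤ) : ℂ`). [cite: Omeara1963, §63B 63:13a] -/
theorem cast_hilbertSymbol_eq_mul_of_toPlace_eq_div (b₀ bc tc : (v.adicCompletion ↥(maximalRealSubfield L))ˣ)
    (h : toPlace v w (b₀ : v.adicCompletion ↥(maximalRealSubfield L)) =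
      toPlace v w (bc : v.adicCompletion ↥(maximalRealSubfield L)) / toPlace v w (tc : v.adicCompletion ↥(maximalRealSubfield L)))
    {d : v.adicCompletion ↥(maximalRealSubfield L)} (hd : d ≠ 0) :
    ((hilbertSymbol (v.adicCompletion ↥(maximalRealSubfield L)) (b₀ : v.adicCompletion ↥(maximalRealSubfield L)) d : ℤ) : ℂ) =
      (hilbertSymbol (v.adicCompletion ↥(maximalRealSubfield L)) (bc : v.adicCompletion ↥(maximalRealSubfield L)) d : ℂ) *
        (hilbertSymbol (v.adicCompletion ↥(maximalRealSubfield L)) (tc : v.adicCompletion ↥(maximalRealSubfield L)) d : ℂ) := by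
  rw [hilbertSymbol_eq_mul_of_toPlace_eq_div L v w b₀ bc tc h hd, Int.cast_mul]

end Place

/-! ## §3 The CM reading in the letter's tokens (`a c : E_v = LocalRing L v`, both norm-one) -/

section CM

variable (L : Type) [Field L] [NumberField L] [IsCMField L] (v : HeightOneSpectrum (𝓞 ↥(maximalRealSubfield L)))
  (w : PlacesOver L v) (hw : IsCMField.complexConj L • w.1 = w.1)

include hw in
/-- **NORM-ONE AT THE PLACE**: `(c ⊗ 1) a · a = 1` in `E_v` gives `σ_w(a_w) · a_w = 1` in `L_w`. [cite: Rogawski1990, §4.9 p. 55] -/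
theorem galAdicCompletionMap_apply_mul_self_of_conjLocal {a : LocalRing L v} (ha : conjLocal L (IsCMField.complexConj L) v a * a = 1) :
    galAdicCompletionMap (L := L) (IsCMField.complexConj L) hw (a w) * a w = 1 := by
  have h : (conjLocal L (IsCMField.complexConj L) v a * a) w = (1 : LocalRing L v) w := by rw [ha]
  rwa [Pi.mul_apply, Pi.one_apply, conjLocal_apply_eq_galAdicCompletionMap L v w hw a] at h

include hw in
/-- **THE DIFFERENCE COORDINATE `bc ∈ L⁺_vˣ` OF THE PAIR `(a, c)`**: for norm-one `a, c ∈ E_v` with `a_w ≠ ± c_w` and a skew `η ≠ 0`,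
`ι_w bc = (a_w∕c_w − c_w∕a_w)∕η` (apply §2 to `z = a_w∕c_w`, `z⁻¹ = c_w∕a_w`). [cite: LabesseLanglands1979, §2 (2.1)] [cite: Labesse2024StabilisationGermesSL2, Prop. 0.0.11] -/
theorem exists_units_toPlace_eq_bcoord_of_normOne {η : w.1.adicCompletion L} (hη : galAdicCompletionMap (L := L) (IsCMField.complexConj L) hw η = -η) (hη0 : η ≠ 0)
    {a c : LocalRing L v} (ha : conjLocal L (IsCMField.complexConj L) v a * a = 1) (hc : conjLocal L (IsCMField.complexConj L) v c * c = 1)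
    (hne : a w ≠ c w) (hne' : a w ≠ -c w) :
    ∃ bc : (v.adicCompletion ↥(maximalRealSubfield L))ˣ, toPlace v w (bc : v.adicCompletion ↥(maximalRealSubfield L)) = (a w / c w - c w / a w) / η := by
  have ha1 := galAdicCompletionMap_apply_mul_self_of_conjLocal L v w hw ha
  have hc1 := galAdicCompletionMap_apply_mul_self_of_conjLocal L v w hw hc
  have ha0 : a w ≠ 0 := fun h0 => by rw [h0, mul_zero] at ha1; exact zero_ne_one ha1
  have hc0 : c w ≠ 0 := fun h0 => by rw [h0, mul_zero] at hc1; exact zero_ne_one hc1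
  have hz : galAdicCompletionMap (L := L) (IsCMField.complexConj L) hw (a w / c w) * (a w / c w) = 1 := by
    rw [map_div₀, div_mul_div_comm, ha1, hc1, div_one]
  have hz1 : a w / c w - 1 ≠ 0 := by rw [sub_ne_zero, Ne, div_eq_one_iff_eq hc0]; exact hne
  have hz1' : a w / c w + 1 ≠ 0 := by
    rw [div_add_one hc0]; exact div_ne_zero (fun h => hne' (eq_neg_of_add_eq_zero_left h)) hc0
  obtain ⟨bc, hbc⟩ := exists_units_toPlace_eq_sub_inv_div L v w hw hη hη0 hz hz1 hz1'
  exact ⟨bc, by rw [hbc, inv_div]⟩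

include hw in
/-- **THE TRACE COORDINATE `tc ∈ L⁺_vˣ` OF THE PAIR `(a, c)`**: for norm-one `a, c ∈ E_v` with `a_w ≠ −c_w`, `ι_w tc = a_w∕c_w + c_w∕a_w + 2`.
[cite: LabesseLanglands1979, §2 (2.1)] [cite: Labesse2024StabilisationGermesSL2, Prop. 0.0.11] -/
theorem exists_units_toPlace_eq_trc_of_normOne {a c : LocalRing L v} (ha : conjLocal L (IsCMField.complexConj L) v a * a = 1)
    (hc : conjLocal L (IsCMField.complexConj L) v c * c = 1) (hne' : a w ≠ -c w) :
    ∃ tc : (v.adicCompletion ↥(maximalRealSubfield L))ˣ, toPlace v w (tc : v.adicCompletion ↥(maximalRealSubfield L)) = a w / c w + c w / a w + 2 := by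
  have ha1 := galAdicCompletionMap_apply_mul_self_of_conjLocal L v w hw ha
  have hc1 := galAdicCompletionMap_apply_mul_self_of_conjLocal L v w hw hc
  have hc0 : c w ≠ 0 := fun h0 => by rw [h0, mul_zero] at hc1; exact zero_ne_one hc1
  have hz : galAdicCompletionMap (L := L) (IsCMField.complexConj L) hw (a w / c w) * (a w / c w) = 1 := by
    rw [map_div₀, div_mul_div_comm, ha1, hc1, div_one]
  have hz1' : a w / c w + 1 ≠ 0 := by
    rw [div_add_one hc0]; exact div_ne_zero (fun h => hne' (eq_neg_of_add_eq_zero_left h)) hc0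
  obtain ⟨tc, htc⟩ := exists_units_toPlace_eq_add_inv_add_two L v w hw hz hz1'
  exact ⟨tc, by rw [htc, inv_div]⟩

omit [IsCMField L] in
/-- **THE CAYLEY PARAMETER OF `a_w∕c_w` IS `bc∕tc`**: `ι_w bc = (a_w∕c_w − c_w∕a_w)∕η`, `ι_w tc = a_w∕c_w + c_w∕a_w + 2`, `a_w, c_w ≠ 0`, `a_w ≠ −c_w` ⇒
`(a_w∕c_w − 1)∕((a_w∕c_w + 1)·η) = ι_w bc ∕ ι_w tc = ι_w (bc · tc⁻¹)` — so `bc · tc⁻¹` is ★ R-4's `b₀`. [cite: LabesseLanglands1979, §2 (2.1)] -/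
theorem toPlace_cayley_eq_div_of_coords {η : w.1.adicCompletion L} {a c : LocalRing L v} (ha0 : a w ≠ 0) (hc0 : c w ≠ 0) (hne' : a w ≠ -c w)
    {bc tc : (v.adicCompletion ↥(maximalRealSubfield L))ˣ}
    (hbc : toPlace v w (bc : v.adicCompletion ↥(maximalRealSubfield L)) = (a w / c w - c w / a w) / η)
    (htc : toPlace v w (tc : v.adicCompletion ↥(maximalRealSubfield L)) = a w / c w + c w / a w + 2) :
    toPlace v w ((bc * tc⁻¹ : (v.adicCompletion ↥(maximalRealSubfield L))ˣ) : v.adicCompletion ↥(maximalRealSubfield L)) =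
      (a w / c w - 1) / ((a w / c w + 1) * η) := by
  have hz1' : a w / c w + 1 ≠ 0 := by
    rw [div_add_one hc0]; exact div_ne_zero (fun h => hne' (eq_neg_of_add_eq_zero_left h)) hc0
  rw [Units.val_mul, Units.val_inv_eq_inv_val, map_mul, map_inv₀, hbc, htc, ← div_eq_mul_inv, ← inv_div (a w) (c w)]
  exact (cayley_eq_canonical_coords (div_ne_zero ha0 hc0) hz1').symm

omit [IsCMField L] in
/-- **THE TRACE COORDINATE NEAR THE SINGULAR LOCUS**: `ι_w tc − 4 = (a_w − c_w)²∕(a_w · c_w)`. [cite: LabesseLanglands1979, §2 (2.2)] -/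
theorem toPlace_trc_sub_four {a c : LocalRing L v} (ha0 : a w ≠ 0) (hc0 : c w ≠ 0) {tc : (v.adicCompletion ↥(maximalRealSubfield L))ˣ}
    (htc : toPlace v w (tc : v.adicCompletion ↥(maximalRealSubfield L)) = a w / c w + c w / a w + 2) :
    toPlace v w (tc : v.adicCompletion ↥(maximalRealSubfield L)) - 4 = (a w - c w) ^ 2 / (a w * c w) := by
  rw [htc]
  field_simp
  ring

include hw in
/-- **`|ι_w tc − 4|_w = |a_w − c_w|_w²`** for norm-one `a, c` (`|a_w| = |c_w| = 1`, ★ `valued_apply_eq_one_of_conjLocal_mul_self`): the trace symbol's argument tends to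
`4 = 2²` quadratically in the depth — the interface for (W′5′-LC). [cite: LabesseLanglands1979, §2 (2.2)] [cite: Rogawski1990, §4.9 p. 55] -/
theorem valued_toPlace_trc_sub_four {a c : LocalRing L v} (ha : conjLocal L (IsCMField.complexConj L) v a * a = 1)
    (hc : conjLocal L (IsCMField.complexConj L) v c * c = 1) {tc : (v.adicCompletion ↥(maximalRealSubfield L))ˣ}
    (htc : toPlace v w (tc : v.adicCompletion ↥(maximalRealSubfield L)) = a w / c w + c w / a w + 2) :
    Valued.v (toPlace v w (tc : v.adicCompletion ↥(maximalRealSubfield L)) - 4) = Valued.v (a w - c w) ^ 2 := by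
  have hva : Valued.v (a w) = 1 := valued_apply_eq_one_of_conjLocal_mul_self L v w hw ha
  have hvc : Valued.v (c w) = 1 := valued_apply_eq_one_of_conjLocal_mul_self L v w hw hc
  have ha0 : a w ≠ 0 := fun h0 => by rw [h0, map_zero] at hva; exact zero_ne_one hva
  have hc0 : c w ≠ 0 := fun h0 => by rw [h0, map_zero] at hvc; exact zero_ne_one hvc
  rw [toPlace_trc_sub_four L v w ha0 hc0 htc, Valuation.map_div, Valuation.map_pow, Valuation.map_mul, hva, hvc, mul_one, div_one]

variable (μ : HeckeCharacter L)
  (hμω : ∀ x : ideleGroup ↥(maximalRealSubfield L), μ (AdeleRing.ideleBaseChange ↥(maximalRealSubfield L) L x) = quadraticHeckeCharCM L x)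

include hw hμω in
/-- **HEAD — ★ R-4's `μ`-PART OF THE RANK-ONE TRANSFER FACTOR, WITH THE CAYLEY SYMBOL SPLIT INTO TORUS COORDINATES.**  Under print's guard there are a level `M₀`, a skew
`η ≠ 0` and a constant `C ≠ 0` (those of ★ `exists_finHeckeValue_sub_inv_eq_mul_hilbertSymbol`) such that for all NORM-ONE `a, c ∈ E_v` (`σa·a = σc·c = 1` — the two
eigenvalues of a torus point) which are DEEP (`|a_w − c_w|_w ≤ |2ϖ_v^{M₀}|_w`) and all units `bc, tc` of `L⁺_v` with `ι_w bc = (a_w∕c_w − c_w∕a_w)∕η` and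
`ι_w tc = a_w∕c_w + c_w∕a_w + 2` (the difference and trace coordinates of the canonical numerator `1 + a_w∕c_w`; they EXIST by `exists_units_toPlace_eq_bcoord_of_normOne` ∕
`exists_units_toPlace_eq_trc_of_normOne`):  **`μ_v(a − c)⁻¹ = μ_v(c)⁻¹ · C⁻¹ · (bc, θ)_v · (tc, θ)_v`**.  (★ R-4's head at `b₀ := bc · tc⁻¹`, then the symbol split.)
[cite: Rogawski1990, §4.9 Lemma 4.9.3 (4.9.2) p. 56; §4.9 p. 55] [cite: LabesseLanglands1979, §2 (2.1)–(2.2)] [cite: Labesse2024StabilisationGermesSL2, Prop. 0.0.11] -/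
theorem exists_finHeckeValue_sub_inv_eq_mul_hilbertSymbol_coords :
    ∃ (M₀ : ℕ) (η : w.1.adicCompletion L) (C : ℂ), galAdicCompletionMap (L := L) (IsCMField.complexConj L) hw η = -η ∧ η ≠ 0 ∧ C ≠ 0 ∧
      ∀ (a c : LocalRing L v) (bc tc : (v.adicCompletion ↥(maximalRealSubfield L))ˣ),
      conjLocal L (IsCMField.complexConj L) v a * a = 1 → conjLocal L (IsCMField.complexConj L) v c * c = 1 →
      Valued.v (a w - c w) ≤ Valued.v (2 * (toPlace v w (HeckeCharacter.uniformizer ↥(maximalRealSubfield L) v : v.adicCompletion ↥(maximalRealSubfield L))) ^ M₀) →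
      toPlace v w (bc : v.adicCompletion ↥(maximalRealSubfield L)) = (a w / c w - c w / a w) / η →
      toPlace v w (tc : v.adicCompletion ↥(maximalRealSubfield L)) = a w / c w + c w / a w + 2 →
      (finHeckeValue L v μ (a - c))⁻¹ =
        (finHeckeValue L v μ c)⁻¹ * C⁻¹ *
          ((hilbertSymbol (v.adicCompletion ↥(maximalRealSubfield L)) (bc : v.adicCompletion ↥(maximalRealSubfield L))
            (algebraMap ↥(maximalRealSubfield L) _ ((cmQuadraticGenerator L : 𝓞 ↥(maximalRealSubfield L)) : ↥(maximalRealSubfield L))) : ℂ) *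
          (hilbertSymbol (v.adicCompletion ↥(maximalRealSubfield L)) (tc : v.adicCompletion ↥(maximalRealSubfield L))
            (algebraMap ↥(maximalRealSubfield L) _ ((cmQuadraticGenerator L : 𝓞 ↥(maximalRealSubfield L)) : ↥(maximalRealSubfield L))) : ℂ)) := by
  obtain ⟨M₀, η, C, hση, hη0, hC0, hcore⟩ := exists_finHeckeValue_sub_inv_eq_mul_hilbertSymbol L v w hw μ hμω
  refine ⟨M₀, η, C, hση, hη0, hC0, fun a c bc tc ha hc hdeep hbc htc => ?_⟩
  have ha1 := galAdicCompletionMap_apply_mul_self_of_conjLocal L v w hw ha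
  have hc1 := galAdicCompletionMap_apply_mul_self_of_conjLocal L v w hw hc
  have ha0 : a w ≠ 0 := fun h0 => by rw [h0, mul_zero] at ha1; exact zero_ne_one ha1
  have hc0 : c w ≠ 0 := fun h0 => by rw [h0, mul_zero] at hc1; exact zero_ne_one hc1
  -- `a_w ≠ −c_w`: otherwise `ι_w tc = 0`
  have hne' : a w ≠ -c w := by
    intro h
    have e1 : a w / c w = -1 := by rw [h, neg_div, div_self hc0]
    have e2 : c w / a w = -1 := by rw [h, div_neg, div_self hc0]
    have h0 : toPlace v w (tc : v.adicCompletion ↥(maximalRealSubfield L)) = 0 := by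
      rw [htc, e1, e2]; norm_num
    exact tc.ne_zero ((map_eq_zero_iff _ (toPlace v w).injective).1 h0)
  have hb₀ := toPlace_cayley_eq_div_of_coords L v w ha0 hc0 hne' hbc htc
  have hθ0 : algebraMap ↥(maximalRealSubfield L) (v.adicCompletion ↥(maximalRealSubfield L))
      ((cmQuadraticGenerator L : 𝓞 ↥(maximalRealSubfield L)) : ↥(maximalRealSubfield L)) ≠ 0 := by
    rw [Ne, map_eq_zero_iff _ (algebraMap ↥(maximalRealSubfield L) (v.adicCompletion ↥(maximalRealSubfield L))).injective]
    exact fun h => not_isSquare_cmQuadraticGenerator L (by rw [h]; exact IsSquare.zero)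
  have hsplit : toPlace v w ((bc * tc⁻¹ : (v.adicCompletion ↥(maximalRealSubfield L))ˣ) : v.adicCompletion ↥(maximalRealSubfield L)) =
      toPlace v w (bc : v.adicCompletion ↥(maximalRealSubfield L)) / toPlace v w (tc : v.adicCompletion ↥(maximalRealSubfield L)) := by
    rw [Units.val_mul, Units.val_inv_eq_inv_val, map_mul, map_inv₀, div_eq_mul_inv]
  rw [hcore a c (bc * tc⁻¹) hc hdeep hb₀, cast_hilbertSymbol_eq_mul_of_toPlace_eq_div L v w (bc * tc⁻¹) bc tc hsplit hθ0]

end CM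

end Literature.NumberTheory.Rogawski1990

end
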